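import Literature.MathematicalPhysics.QuantumFieldTheory.Balaban1983to89.Beta.RemainderDecay190SectG
import Literature.MathematicalPhysics.QuantumFieldTheory.Balaban1983to89.Beta.RemainderRowSum

/-!
# [Balaban1985Variational] Sect. G (182)–(190) ⟶ the (190)-socket of the (D4) remainder chain ON THE SITE-TORUS CARRIER:
# the NODE-D join `RemainderDecay190SectG.h190_of_sectG` with its three geometry letters — (2.54), d ≥ 0, the row sum (2.61) —
# DISCHARGED for the family `toB6 (torusGeom (Nf n) (η n) (L n) (M n)) (R n) (H n)` (`Beta.RemainderDecay190SectGTorus`)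

statement-level skeleton of published theorems with citation tags; proofs where landed; nothing here is a claim
about the Yang–Mills mass gap.

HONEST FRAMING (cell rule).  Bookkeeping for the k-uniform remainder chain of row (D4) (`RemainderConst` ⇐ ONE
`ChainTFac190` instance, `Beta.RemainderDecay190`); discharges NOTHING of `BetaPertH`; NOT B12 Thm 2, NOT the continuum
limit, NOT Clay.  Unit `b2b-balaban-beta-an4` gen 91 (BINDER row D4 OWNER; cell pub-balaban).  Imports
`Beta.RemainderDecay190SectG` (gen 89: the field `Data190.h190` joined to the per-torus Sect. G letters) and
`Beta.RemainderRowSum` (gen 90: the field `Data190.hrow` discharged per geometry family) ONLY; nothing edited.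

WHAT.  `RemainderDecay190SectG.h190_of_sectG` / `nonempty_data190_of_sectG` are stated over an ARBITRARY family of
multiscale geometries `gn n : B6.Geometry` and therefore carry three geometry hypotheses — `htri` ((2.54) of
[Balaban1984PropagatorsII]), `hd` (d(y,y′) ≥ 0) and `hrow` (Lemma 2.1 (2.61) at a rate σ ≤ ⅛δ₀ with ONE constant for
all tori).  On the carrier on which the tree's NODE-O objects live — the one-scale SITE torus `UT (Nf n)` with the
periodic ℓ¹ distance `tdist1`, in the `toB6` repackaging of `B9Thm37GlueTorus.torusGeom` (the geometry of
`B13JointWalkExpansion`, `B13TermWalkData`, `Gaps.D4Walk*`) — all three are THEOREMS of the tree: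
`B9Thm37GlueTorus.htri_torusGeom`, `B9Thm37GlueTorus.tdist1_nonneg`, and gen 90's `RemainderRowSum.hrow_torusGeom`
(`Σ_{y′} e^{−σ d(y,y′)} ≤ c₀(σ∕δ₀)^ν` uniformly in the torus sizes).  This file substitutes them:
* §1 `h190_of_sectG_torusGeom` — the TYPE of `Data190.h190` (`∀ n i, Ineq190 (bB n) (bout n i) (dH n) Cst δ15`) for Sect. G
  data given per torus on `gn n := toB6 (torusGeom (Nf n) (η n) (L n) (M n)) (R n) (H n)`, from the located leaves of
  print with COMMON O(1) letters (exactly the list of `h190_of_sectG` minus `htri`, `hd`, `hrow`), any rate `0 < σ ≤ ⅛δ₀`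
  and any row-sum constant `c ≥ c₀(σ∕δ₀)^ν` — every remaining letter TORUS-FREE; `h190_of_sectG_torusGeom_eq182` the
  variant with δ𝓗 DEFINED by (182).
* §2 `nonempty_data190_of_sectG_torusGeom` — the JOIN CERTIFICATE `Nonempty (Data190 d Mc N Wn q)` on this carrier: the
  Sect. G letters + the (4.4)-dictionary letters (`hdom`, `hm`, `hD`) + the numerics `q` (with `0 < q.σ ≤ ⅛δ₀`,
  `c₀(q.σ∕δ₀)^ν ≤ q.cR`) inhabit the socket with `gn`, `hdist`, `hrow` FILLED BY NAME — the builder's residual input list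
  for NODE D on this carrier is: the operators G̃, W, Δ⁽²⁾H₀, H₀, H, 𝔄₀, 𝔇, δ𝓗 per torus AS TERMS (NODE O.2) with their
  located kernel letters ((189) author-omitted — cell GAPS G-B11-G2 —, G̃, Δ⁽²⁾H₀, H₀, H, 𝔇, (182)/(184)/(188), q < 1 of
  (187)), the block norms with cutting constants ≤ κ̄, and the (T12) dictionary letters; NO geometry letter.
* §3 THE ENTRYWISE CURRENCY (the dictionary with the tree's NODE-O walk objects, whose majorants are bounds on MATRIX
  ENTRIES — `B13JointWalkExpansion.WalkMajorants`, `B9SectDWalk.MajSumLe`): on the one-scale site torus the blocks of 𝔅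
  ARE the sites, so with the SHARP one-site sizes `B11SectG.BlockNorm.ofBlocks (toB6 (torusGeom …)) (fun y => y)`
  (loc_y f = |f(y)| — `loc_ofBlocks_id` —, sharp cut, cutting constant κ = 1) a block majorant `HasMaj b b T K` IS the
  entrywise bound `|T(δ_{y′})(y)| ≤ K(y,y′)` (`hasMaj_ofBlocks_id_of_entry` ∕ `entry_le_of_hasMaj_ofBlocks_id`, via
  `B9Thm34Inv.hasMajorant_id_iff` + `B11SectG.hasMaj_of_hasMajorant`); hence **`entry190_of_sectG_torusGeom`** — (190) AS AN
  ENTRYWISE KERNEL BOUND `|δ𝓗_n(δ_{y′})(y)| ≤ Cst·e^{−⅛δ15·d₁(y,y′)}` for all tori n and sites y, y′, from ENTRYWISE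
  exponential bounds of the scalar-model operators G̃, W ((189)), Δ⁽²⁾H₀, H₀, H, 𝔇, 𝔄₀ ((188)) on `UT (Nf n) → ℝ` + the
  carriers (184)/(182) + the numerics with EVERY cutting constant = 1 and the row-sum constant c ≥ c₀(σ∕δ₀)^ν (scalar model
  of the 𝔤-valued fields, as everywhere in the cell's B9 typing — `B9Thm34Inv`, `B6RandomWalkSection`).
WHAT IS *NOT* DONE: no operator of Bałaban's is constructed (they are parameters); which `Nf n` ∕ which blocks ARE
Bałaban's 𝔅 for the k-th step on the n-th torus is NODE O's choice (the one-scale site torus is the carrier of the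
tree's walk objects, not of the multiscale 𝔅_k of [15] — a builder on a multiscale carrier uses `h190_of_sectG` with
`RemainderRowSum.hrow_geomR0` instead); row D4 class UNCHANGED (instance 0∕1; critical-path width 0 = NODE O; D4
DISCHARGE NO DATE).  No `def`, no named fact, no `sorry`, standard axioms.
HONEST DEPENDENCY: continuum YM on T⁴ ⇐ BetaPertH ∧ nine spine estimates (0/9 proved); BetaPertH ⇐ (D1) ∧ (D4) ∧
CAP+tail; G-an2-4 gates asym, D1 and NE2/3/4.

Sources: [15] = T. Bałaban, *The variational problem and background fields in renormalization group method for lattice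
gauge theories*, Commun. Math. Phys. **102** (1985) 277–309 [Balaban1985Variational], Sect. G (182)–(190) pp. 307–308;
[3] = *Propagators and renormalization transformations for lattice gauge theories. II*, Commun. Math. Phys. **96** (1984)
223–250 [Balaban1984PropagatorsII], (2.46) p. 231, (2.54) p. 233, Lemma 2.1 (2.61) p. 234; [I] = *Renormalization group
approach to lattice gauge field theories. I*, Commun. Math. Phys. **109** (1987) 249–301 [Balaban1987RG1], (4.4) p. 281,
p. 282.
-/

namespace Literature.MathematicalPhysics.QuantumFieldTheory.Balaban1983to89.Beta.RemainderDecay190SectGTorus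

open Literature.MathematicalPhysics.QuantumFieldTheory.Balaban1983to89 B11SectG B6RandomWalk
open Literature.MathematicalPhysics.QuantumFieldTheory.Balaban1983to89.B9Thm34Ext (toB6)
open Literature.MathematicalPhysics.QuantumFieldTheory.Balaban1983to89.B9Thm37GlueTorus
  (torusGeom tdist1 tdist1_nonneg htri_torusGeom)
open Literature.MathematicalPhysics.QuantumFieldTheory.Balaban1983to89.B5TorusCover (UT)
open Literature.MathematicalPhysics.QuantumFieldTheory.Balaban1983to89.Beta.RemainderDecay190SectG
  (h190_of_sectG)
open Literature.MathematicalPhysics.QuantumFieldTheory.Balaban1983to89.Beta.RemainderRowSum (hrow_torusGeom)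

/-! ## 0. The two remaining geometry letters on the site torus (for the record; (2.54) is `htri_torusGeom`) -/

section Letters

variable {ν : ℕ}

/-- d(y, y′) ≥ 0 for the one-scale site-torus geometry in the `toB6` repackaging (the letter `hd` ∕ `Data190.hdist`).
[cite: Balaban1984PropagatorsII, (2.46) p.231] -/
theorem hd_torusGeom (Nf : Fin ν → ℕ) [∀ i, NeZero (Nf i)] (η L M R : ℝ) (H : Prop) :
    ∀ a b : (toB6 (torusGeom Nf η L M) R H).Site, 0 ≤ (toB6 (torusGeom Nf η L M) R H).dist a b :=
  fun a b => tdist1_nonneg a b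

/-- The family form of `hd_torusGeom`: `∀ n a b, 0 ≤ d_n(a, b)` — literally the type of `Data190.hdist` for
`gn := fun n => toB6 (torusGeom (Nf n) (η n) (L n) (M n)) (R n) (H n)`. [cite: Balaban1984PropagatorsII, (2.46) p.231] -/
theorem hdist_torusGeom {ι : Type*} (Nf : ι → Fin ν → ℕ) [∀ n i, NeZero (Nf n i)] (η L M R : ι → ℝ) (H : ι → Prop) :
    ∀ n (a b : (toB6 (torusGeom (Nf n) (η n) (L n) (M n)) (R n) (H n)).Site),
      0 ≤ (toB6 (torusGeom (Nf n) (η n) (L n) (M n)) (R n) (H n)).dist a b :=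
  fun n a b => hd_torusGeom (Nf n) (η n) (L n) (M n) (R n) (H n) a b

/-- The family form of (2.54): `∀ n, Triangle254 (gn n)` on the site-torus carrier.
[cite: Balaban1984PropagatorsII, (2.54) p.233] -/
theorem htri_torusGeom_family {ι : Type*} (Nf : ι → Fin ν → ℕ) [∀ n i, NeZero (Nf n i)] (η L M R : ι → ℝ)
    (H : ι → Prop) : ∀ n, Triangle254 (toB6 (torusGeom (Nf n) (η n) (L n) (M n)) (R n) (H n)) :=
  fun n => htri_torusGeom (η n) (L n) (M n) (R n) (H n)

end Letters

/-! ## 1. `Data190.h190` from the per-torus Sect. G letters ON THE SITE TORUS — no geometry hypothesis left -/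

section Join

variable {ν : ℕ} {Nf : ℕ → Fin ν → ℕ} [∀ n i, NeZero (Nf n i)] {η L M R : ℕ → ℝ} {H : ℕ → Prop}
variable {I : Type} {FB FA F3 : ℕ → Type} [∀ n, AddCommGroup (FB n)] [∀ n, Module ℝ (FB n)]
  [∀ n, AddCommGroup (FA n)] [∀ n, Module ℝ (FA n)] [∀ n, AddCommGroup (F3 n)] [∀ n, Module ℝ (F3 n)]

/-- **THE (190)-FIELD OF THE (D4) SOCKET ON THE SITE-TORUS CARRIER** — `RemainderDecay190SectG.h190_of_sectG` with
`gn n := toB6 (torusGeom (Nf n) (η n) (L n) (M n)) (R n) (H n)` and its three geometry hypotheses DISCHARGED: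
(2.54) by `htri_torusGeom`, d ≥ 0 by `tdist1_nonneg`, the row sum (2.61) at the rate `σ` (any `0 < σ ≤ ⅛δ₀`) with ANY
constant `c ≥ c₀(σ∕δ₀)^ν` by `RemainderRowSum.hrow_torusGeom` — ONE constant for all tori.  Every remaining hypothesis is
a located leaf of [15] Sect. G with torus-free O(1) letters (G̃ `hG`∕`hG₂`, (189) `h189` — author-omitted, cell GAPS
G-B11-G2 —, Δ⁽²⁾H₀ `hD2H0`, H₀ `hH0`∕`hH0₂`, H `hH₂`, 𝔇 `hDfr`, the carriers (184) `h184`, (188) `h188`, (182) `h182`,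
the Neumann ratio of (187) at the cutting bounds `hq`) or a numeric comparison (`hCst`, `hδ15`).  Conclusion = the TYPE
of `Data190.h190`. [cite: Balaban1985Variational, (182)-(190) pp.307-308; Balaban1984PropagatorsII, Lemma 2.1 (2.61) p.234, (2.54) p.233] -/
theorem h190_of_sectG_torusGeom
    (bB : (n : ℕ) → BlockNorm (toB6 (torusGeom (Nf n) (η n) (L n) (M n)) (R n) (H n)) (FB n))
    (bN : (n : ℕ) → BlockNorm (toB6 (torusGeom (Nf n) (η n) (L n) (M n)) (R n) (H n)) (FA n))
    (b3 : (n : ℕ) → BlockNorm (toB6 (torusGeom (Nf n) (η n) (L n) (M n)) (R n) (H n)) (F3 n))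
    (bout : (n : ℕ) → I → BlockNorm (toB6 (torusGeom (Nf n) (η n) (L n) (M n)) (R n) (H n)) (FA n))
    (Gt : (n : ℕ) → F3 n →ₗ[ℝ] FA n) (W : (n : ℕ) → FA n →ₗ[ℝ] F3 n) (D2H0 : (n : ℕ) → FB n →ₗ[ℝ] F3 n)
    (H0 Hk A0 dH : (n : ℕ) → FB n →ₗ[ℝ] FA n) (Dfr : (n : ℕ) → FA n →ₗ[ℝ] FB n) (M₀ : ℕ → ℝ)
    {δ₀ σ c BG BG₂ θW cΔ A₀ A₀₂ AH₂ θD κB κN κ₃ Cst δ15 : ℝ}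
    (hδ₀ : 0 < δ₀) (hσ₀ : 0 < σ) (hσ : σ ≤ δ₀ / 8) (hc : B6.c0 δ₀ (σ / δ₀) ^ ν ≤ c)
    (hBG : 0 ≤ BG) (hBG₂ : 0 ≤ BG₂) (hθW : 0 ≤ θW) (hcΔ : 0 ≤ cΔ) (hA₀ : 0 ≤ A₀) (hA₀₂ : 0 ≤ A₀₂)
    (hAH₂ : 0 ≤ AH₂) (hθD : 0 ≤ θD) (hM₀ : ∀ n, 0 ≤ M₀ n)
    (hκB : ∀ n, (bB n).κ ≤ κB) (hκN : ∀ n, (bN n).κ ≤ κN) (hκ₃ : ∀ n, (b3 n).κ ≤ κ₃)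
    (hG : ∀ n, HasMaj (b3 n) (bN n) (Gt n) (fun y y' => BG * Real.exp (-(δ₀ * tdist1 (Nf n) y y'))))
    (hG₂ : ∀ n i, HasMaj (b3 n) (bout n i) (Gt n) (fun y y' => BG₂ * Real.exp (-(δ₀ * tdist1 (Nf n) y y'))))
    (h189 : ∀ n, Ineq189 (bN n) (b3 n) (W n) θW δ₀)
    (hD2H0 : ∀ n, HasMaj (bB n) (b3 n) (D2H0 n) (fun y y' => cΔ * Real.exp (-(δ₀ * tdist1 (Nf n) y y'))))
    (hH0 : ∀ n, HasMaj (bB n) (bN n) (H0 n) (fun y y' => A₀ * Real.exp (-(δ₀ * tdist1 (Nf n) y y'))))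
    (hH0₂ : ∀ n i, HasMaj (bB n) (bout n i) (H0 n) (fun y y' => A₀₂ * Real.exp (-(δ₀ * tdist1 (Nf n) y y'))))
    (hH₂ : ∀ n i, HasMaj (bB n) (bout n i) (Hk n) (fun y y' => AH₂ * Real.exp (-(δ₀ / 2 * tdist1 (Nf n) y y'))))
    (hDfr : ∀ n, HasMaj (bN n) (bB n) (Dfr n) (fun y y' => θD * Real.exp (-(δ₀ / 2 * tdist1 (Nf n) y y'))))
    (h184 : ∀ n, Eq184 (A0 n) (H0 n) (Gt n) (W n) (D2H0 n)) (h188 : ∀ n, Bound188 (bB n) (bN n) (A0 n) (M₀ n))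
    (h182 : ∀ n, Eq182 (dH n) (A0 n) (H0 n) (Hk n) (Dfr n))
    (hq : qG κ₃ κN BG θW c < 1)
    (hCst : (κ₃ * BG₂ * (cΔ + κN * θW * (A₀ + constA0 κ₃ κN BG θW cΔ A₀ c) * c) * c + A₀₂) +
        κB * AH₂ * (κN * θD * (constA0 κ₃ κN BG θW cΔ A₀ c + A₀) * c) * c ≤ Cst)
    (hδ15 : δ15 ≤ δ₀) :
    ∀ n i, Ineq190 (bB n) (bout n i) (dH n) Cst δ15 :=
  h190_of_sectG (gn := fun n => toB6 (torusGeom (Nf n) (η n) (L n) (M n)) (R n) (H n))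
    bB bN b3 bout Gt W D2H0 H0 Hk A0 dH Dfr M₀
    (htri_torusGeom_family Nf η L M R H) (hdist_torusGeom Nf η L M R H) hδ₀.le
    (hrow_torusGeom Nf η L M R H hδ₀ hσ₀ hc) hσ
    hBG hBG₂ hθW hcΔ hA₀ hA₀₂ hAH₂ hθD hM₀ hκB hκN hκ₃ hG hG₂ h189 hD2H0 hH0 hH0₂ hH₂ hDfr h184 h188 h182 hq hCst hδ15

/-- **The same with δ𝓗 DEFINED by (182)** — `dH n := (𝔄₀ + H₀) − H·𝔇·(𝔄₀ + H₀)`, the carrier `Eq182` by `rfl`: a builder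
with 𝔄₀, H₀, H, 𝔇 as terms on the site torus writes `dHn := …`, `h190 := h190_of_sectG_torusGeom_eq182 …` with no
operator identity and no geometry letter left. [cite: Balaban1985Variational, (182) p.307, (190) p.308] -/
theorem h190_of_sectG_torusGeom_eq182
    (bB : (n : ℕ) → BlockNorm (toB6 (torusGeom (Nf n) (η n) (L n) (M n)) (R n) (H n)) (FB n))
    (bN : (n : ℕ) → BlockNorm (toB6 (torusGeom (Nf n) (η n) (L n) (M n)) (R n) (H n)) (FA n))
    (b3 : (n : ℕ) → BlockNorm (toB6 (torusGeom (Nf n) (η n) (L n) (M n)) (R n) (H n)) (F3 n))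
    (bout : (n : ℕ) → I → BlockNorm (toB6 (torusGeom (Nf n) (η n) (L n) (M n)) (R n) (H n)) (FA n))
    (Gt : (n : ℕ) → F3 n →ₗ[ℝ] FA n) (W : (n : ℕ) → FA n →ₗ[ℝ] F3 n) (D2H0 : (n : ℕ) → FB n →ₗ[ℝ] F3 n)
    (H0 Hk A0 : (n : ℕ) → FB n →ₗ[ℝ] FA n) (Dfr : (n : ℕ) → FA n →ₗ[ℝ] FB n) (M₀ : ℕ → ℝ)
    {δ₀ σ c BG BG₂ θW cΔ A₀ A₀₂ AH₂ θD κB κN κ₃ Cst δ15 : ℝ}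
    (hδ₀ : 0 < δ₀) (hσ₀ : 0 < σ) (hσ : σ ≤ δ₀ / 8) (hc : B6.c0 δ₀ (σ / δ₀) ^ ν ≤ c)
    (hBG : 0 ≤ BG) (hBG₂ : 0 ≤ BG₂) (hθW : 0 ≤ θW) (hcΔ : 0 ≤ cΔ) (hA₀ : 0 ≤ A₀) (hA₀₂ : 0 ≤ A₀₂)
    (hAH₂ : 0 ≤ AH₂) (hθD : 0 ≤ θD) (hM₀ : ∀ n, 0 ≤ M₀ n)
    (hκB : ∀ n, (bB n).κ ≤ κB) (hκN : ∀ n, (bN n).κ ≤ κN) (hκ₃ : ∀ n, (b3 n).κ ≤ κ₃)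
    (hG : ∀ n, HasMaj (b3 n) (bN n) (Gt n) (fun y y' => BG * Real.exp (-(δ₀ * tdist1 (Nf n) y y'))))
    (hG₂ : ∀ n i, HasMaj (b3 n) (bout n i) (Gt n) (fun y y' => BG₂ * Real.exp (-(δ₀ * tdist1 (Nf n) y y'))))
    (h189 : ∀ n, Ineq189 (bN n) (b3 n) (W n) θW δ₀)
    (hD2H0 : ∀ n, HasMaj (bB n) (b3 n) (D2H0 n) (fun y y' => cΔ * Real.exp (-(δ₀ * tdist1 (Nf n) y y'))))
    (hH0 : ∀ n, HasMaj (bB n) (bN n) (H0 n) (fun y y' => A₀ * Real.exp (-(δ₀ * tdist1 (Nf n) y y'))))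
    (hH0₂ : ∀ n i, HasMaj (bB n) (bout n i) (H0 n) (fun y y' => A₀₂ * Real.exp (-(δ₀ * tdist1 (Nf n) y y'))))
    (hH₂ : ∀ n i, HasMaj (bB n) (bout n i) (Hk n) (fun y y' => AH₂ * Real.exp (-(δ₀ / 2 * tdist1 (Nf n) y y'))))
    (hDfr : ∀ n, HasMaj (bN n) (bB n) (Dfr n) (fun y y' => θD * Real.exp (-(δ₀ / 2 * tdist1 (Nf n) y y'))))
    (h184 : ∀ n, Eq184 (A0 n) (H0 n) (Gt n) (W n) (D2H0 n)) (h188 : ∀ n, Bound188 (bB n) (bN n) (A0 n) (M₀ n))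
    (hq : qG κ₃ κN BG θW c < 1)
    (hCst : (κ₃ * BG₂ * (cΔ + κN * θW * (A₀ + constA0 κ₃ κN BG θW cΔ A₀ c) * c) * c + A₀₂) +
        κB * AH₂ * (κN * θD * (constA0 κ₃ κN BG θW cΔ A₀ c + A₀) * c) * c ≤ Cst)
    (hδ15 : δ15 ≤ δ₀) :
    ∀ n i, Ineq190 (bB n) (bout n i) ((A0 n + H0 n) - Hk n ∘ₗ (Dfr n ∘ₗ (A0 n + H0 n))) Cst δ15 :=
  h190_of_sectG_torusGeom bB bN b3 bout Gt W D2H0 H0 Hk A0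
    (fun n => (A0 n + H0 n) - Hk n ∘ₗ (Dfr n ∘ₗ (A0 n + H0 n))) Dfr M₀ hδ₀ hσ₀ hσ hc hBG hBG₂ hθW hcΔ hA₀ hA₀₂ hAH₂
    hθD hM₀ hκB hκN hκ₃ hG hG₂ h189 hD2H0 hH0 hH0₂ hH₂ hDfr h184 h188 (fun _ => rfl) hq hCst hδ15

end Join

/-! ## 2. JOIN CERTIFICATE on the site torus: Sect. G letters + (4.4)-dictionary letters INHABIT `Data190`, geometry filled -/

section Certificate

open Literature.MathematicalPhysics.QuantumFieldTheory.Balaban1983to89.B12Decay510FromB11 (NormDominated UnitFieldsLocalised)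
open Literature.MathematicalPhysics.QuantumFieldTheory.Balaban1983to89.TreeLengthTorus (TPt TDom tsys)
open Literature.MathematicalPhysics.QuantumFieldTheory.Balaban1983to89.B12Decay510Torus (geomT)
open Literature.MathematicalPhysics.QuantumFieldTheory.Balaban1983to89.Beta.RemainderDecay190 (Data190 Consts190)

variable {ν : ℕ} {Nf : ℕ → Fin ν → ℕ} [∀ n i, NeZero (Nf n i)] {η L M R : ℕ → ℝ} {H : ℕ → Prop}
variable {d Mc : ℕ} [NeZero Mc] {N : ℕ → ℕ} [∀ n, NeZero (N n)] {Wn : ℕ → Type} [∀ n, NormedAddCommGroup (Wn n)]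
  {q : Consts190} {I : Type} {FB FA F3 : ℕ → Type} [∀ n, AddCommGroup (FB n)] [∀ n, Module ℝ (FB n)]
  [∀ n, AddCommGroup (FA n)] [∀ n, Module ℝ (FA n)] [∀ n, AddCommGroup (F3 n)] [∀ n, Module ℝ (F3 n)]

/-- **JOIN CERTIFICATE ON THE SITE-TORUS CARRIER** — the (190)-socket `Data190 d Mc N Wn q` of the (D4) remainder chain
IS INHABITED with `gn := fun n => toB6 (torusGeom (Nf n) (η n) (L n) (M n)) (R n) (H n)` by: the per-torus Sect. G letters
(§1: `dHn := dH`, `h190 := h190_of_sectG_torusGeom …` at the record's `q.Cst`, `q.δ15`, row-sum rate `q.σ` and constant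
`q.cR`, B-cutting bound `q.κB`), the (4.4)-dictionary letters the socket carries verbatim (`hdom`, `hm`, `hD` — [I] p. 282
↔ [15], read through `B12Decay510FromB11`), and the numerics `0 < q.σ ≤ ⅛δ₀`, `c₀(q.σ∕δ₀)^ν ≤ q.cR`; the socket's
geometry fields `hdist` and `hrow` are FILLED BY NAME (`tdist1_nonneg`, `RemainderRowSum.hrow_torusGeom`).  Nothing of
Bałaban's is constructed: the operators, block norms and dictionary data are parameters (NODE O); the inhabitant is the
anonymous constructor in the proof; no `def` is introduced.
[cite: Balaban1985Variational, (190) p.308; Balaban1987RG1, (4.4) p.281 and p.282; Balaban1984PropagatorsII, (2.61) p.234] -/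
theorem nonempty_data190_of_sectG_torusGeom
    (bB : (n : ℕ) → BlockNorm (toB6 (torusGeom (Nf n) (η n) (L n) (M n)) (R n) (H n)) (FB n))
    (bN : (n : ℕ) → BlockNorm (toB6 (torusGeom (Nf n) (η n) (L n) (M n)) (R n) (H n)) (FA n))
    (b3 : (n : ℕ) → BlockNorm (toB6 (torusGeom (Nf n) (η n) (L n) (M n)) (R n) (H n)) (F3 n))
    (bout : (n : ℕ) → I → BlockNorm (toB6 (torusGeom (Nf n) (η n) (L n) (M n)) (R n) (H n)) (FA n))
    (Gt : (n : ℕ) → F3 n →ₗ[ℝ] FA n) (W : (n : ℕ) → FA n →ₗ[ℝ] F3 n) (D2H0 : (n : ℕ) → FB n →ₗ[ℝ] F3 n)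
    (H0 Hk A0 dH : (n : ℕ) → FB n →ₗ[ℝ] FA n) (Dfr : (n : ℕ) → FA n →ₗ[ℝ] FB n) (M₀ : ℕ → ℝ)
    (blk : (n : ℕ) → TDom d (N n) → Finset (UT (Nf n))) (ι : (n : ℕ) → TDom d (N n) → FA n → Wn n)
    (u : (n : ℕ) → TPt d (N n * Mc) → FB n)
    {δ₀ BG BG₂ θW cΔ A₀ A₀₂ AH₂ θD κN κ₃ : ℝ}
    (hδ₀ : 0 < δ₀) (hσ₀ : 0 < q.σ) (hσ : q.σ ≤ δ₀ / 8) (hcR : B6.c0 δ₀ (q.σ / δ₀) ^ ν ≤ q.cR)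
    (hBG : 0 ≤ BG) (hBG₂ : 0 ≤ BG₂) (hθW : 0 ≤ θW) (hcΔ : 0 ≤ cΔ) (hA₀ : 0 ≤ A₀) (hA₀₂ : 0 ≤ A₀₂)
    (hAH₂ : 0 ≤ AH₂) (hθD : 0 ≤ θD) (hM₀ : ∀ n, 0 ≤ M₀ n)
    (hκB : ∀ n, (bB n).κ ≤ q.κB) (hκN : ∀ n, (bN n).κ ≤ κN) (hκ₃ : ∀ n, (b3 n).κ ≤ κ₃)
    (hG : ∀ n, HasMaj (b3 n) (bN n) (Gt n) (fun y y' => BG * Real.exp (-(δ₀ * tdist1 (Nf n) y y'))))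
    (hG₂ : ∀ n i, HasMaj (b3 n) (bout n i) (Gt n) (fun y y' => BG₂ * Real.exp (-(δ₀ * tdist1 (Nf n) y y'))))
    (h189 : ∀ n, Ineq189 (bN n) (b3 n) (W n) θW δ₀)
    (hD2H0 : ∀ n, HasMaj (bB n) (b3 n) (D2H0 n) (fun y y' => cΔ * Real.exp (-(δ₀ * tdist1 (Nf n) y y'))))
    (hH0 : ∀ n, HasMaj (bB n) (bN n) (H0 n) (fun y y' => A₀ * Real.exp (-(δ₀ * tdist1 (Nf n) y y'))))
    (hH0₂ : ∀ n i, HasMaj (bB n) (bout n i) (H0 n) (fun y y' => A₀₂ * Real.exp (-(δ₀ * tdist1 (Nf n) y y'))))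
    (hH₂ : ∀ n i, HasMaj (bB n) (bout n i) (Hk n) (fun y y' => AH₂ * Real.exp (-(δ₀ / 2 * tdist1 (Nf n) y y'))))
    (hDfr : ∀ n, HasMaj (bN n) (bB n) (Dfr n) (fun y y' => θD * Real.exp (-(δ₀ / 2 * tdist1 (Nf n) y y'))))
    (h184 : ∀ n, Eq184 (A0 n) (H0 n) (Gt n) (W n) (D2H0 n)) (h188 : ∀ n, Bound188 (bB n) (bN n) (A0 n) (M₀ n))
    (h182 : ∀ n, Eq182 (dH n) (A0 n) (H0 n) (Hk n) (Dfr n))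
    (hq : qG κ₃ κN BG θW q.cR < 1)
    (hCst : (κ₃ * BG₂ * (cΔ + κN * θW * (A₀ + constA0 κ₃ κN BG θW cΔ A₀ q.cR) * q.cR) * q.cR + A₀₂) +
        q.κB * AH₂ * (κN * θD * (constA0 κ₃ κN BG θW cΔ A₀ q.cR + A₀) * q.cR) * q.cR ≤ q.Cst)
    (hδ15 : q.δ15 ≤ δ₀)
    (hdom : ∀ n, NormDominated (S := tsys d (N n)) (bout n) (blk n) (V := fun _ => Wn n) (ι n))
    (hm : ∀ n x y', (bB n).loc y' (u n x) ≤ q.m)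
    (hD : ∀ n, UnitFieldsLocalised (bB n) (geomT d (N n) Mc) (blk n) (u n) q.θ) :
    Nonempty (Data190 d Mc N Wn q) :=
  ⟨{ I := I, gn := fun n => toB6 (torusGeom (Nf n) (η n) (L n) (M n)) (R n) (H n),
     FBn := FB, FAn := FA, bBn := bB, boutn := bout, dHn := dH, blkn := blk, ιn := ι, un := u,
     h190 := h190_of_sectG_torusGeom bB bN b3 bout Gt W D2H0 H0 Hk A0 dH Dfr M₀ hδ₀ hσ₀ hσ hcR hBG hBG₂ hθW hcΔ hA₀
       hA₀₂ hAH₂ hθD hM₀ hκB hκN hκ₃ hG hG₂ h189 hD2H0 hH0 hH0₂ hH₂ hDfr h184 h188 h182 hq hCst hδ15,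
     hdist := hdist_torusGeom Nf η L M R H,
     hrow := hrow_torusGeom Nf η L M R H hδ₀ hσ₀ hcR,
     hκB := hκB, hdom := hdom, hm := hm, hD := hD }⟩

end Certificate

/-! ## 3. THE ENTRYWISE CURRENCY on the site torus: with the sharp one-site sizes every letter is a matrix-entry bound -/

section Entrywise

open Literature.MathematicalPhysics.QuantumFieldTheory.Balaban1983to89.B9Thm34Inv (entry hasMajorant_id_iff)
open Literature.MathematicalPhysics.QuantumFieldTheory.Balaban1983to89.B11SectG (hasMaj_of_hasMajorant)

variable {g : B9.Geometry} [Fintype g.Site] [DecidableEq g.Site] {R : ℝ} {H : Prop}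

/-- **The sharp one-site size**: for the identity block map (every site its own block — the one-scale 𝔅 = Λ₀ of the site
torus, `toB6` repackaging of a `B9.Geometry`) the sup-over-the-block size of `B11SectG.BlockNorm.ofBlocks` is
`loc_y f = |f(y)|`. [folklore] [cite: Balaban1984PropagatorsII, (2.51)–(2.52) p.232] -/
theorem loc_ofBlocks_id (y : g.Site) (f : g.Site → ℝ) :
    (BlockNorm.ofBlocks (toB6 g R H) (fun x : g.Site => x)).loc y f = |f y| := by
  have h : (BlockNorm.ofBlocks (toB6 g R H) (fun x : g.Site => x)).loc y f =
      ⨆ x : g.Site, @ite ℝ (x = y) (Classical.propDecidable _) |f x| 0 := rfl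
  haveI : Nonempty g.Site := ⟨y⟩
  rw [h]
  refine le_antisymm (ciSup_le fun x => ?_) (le_ciSup_of_le (Finite.bddAbove_range _) y ?_)
  · by_cases hx : x = y
    · rw [if_pos hx, hx]
    · rw [if_neg hx]
      exact abs_nonneg _
  · rw [if_pos rfl]

/-- **Entrywise bound ⟹ block majorant in the sharp one-site sizes**: on a geometry whose blocks are its sites (block map
= identity, `toB6` repackaging of a `B9.Geometry`), `|T(δ_{y′})(y)| ≤ K(y,y′)` with `K ≥ 0` gives
`HasMaj (ofBlocks · id) (ofBlocks · id) T K` — `B9Thm34Inv.hasMajorant_id_iff` ([3] (2.51) for the trivial block map IS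
the entry bound) followed by the conservativity `B11SectG.hasMaj_of_hasMajorant`.
[cite: Balaban1984PropagatorsII, (2.51) p.232; Balaban1985Variational, (189)–(190) p.308] -/
theorem hasMaj_ofBlocks_id_of_entry {T : Module.End ℝ (g.Site → ℝ)} {K : g.Site → g.Site → ℝ}
    (hK : ∀ a b, 0 ≤ K a b) (h : ∀ y y' : g.Site, |entry T y y'| ≤ K y y') :
    HasMaj (BlockNorm.ofBlocks (toB6 g R H) (fun x : g.Site => x)) (BlockNorm.ofBlocks (toB6 g R H) (fun x : g.Site => x))
      T K :=
  hasMaj_of_hasMajorant (g := toB6 g R H) (fun x : g.Site => x) hK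
    ((hasMajorant_id_iff (R := R) (H := H) T K).mpr h)

/-- **Block majorant in the sharp one-site sizes ⟹ entrywise bound**: `HasMaj (ofBlocks · id) (ofBlocks · id) T K` gives
`|T(δ_{y′})(y)| ≤ K(y,y′)` (test the majorant on μ = δ_{y′}, localised at y′ with size 1). [folklore]
[cite: Balaban1984PropagatorsII, (2.51) p.232; Balaban1985Variational, (190) p.308] -/
theorem entry_le_of_hasMaj_ofBlocks_id {T : Module.End ℝ (g.Site → ℝ)} {K : g.Site → g.Site → ℝ}
    (h : HasMaj (BlockNorm.ofBlocks (toB6 g R H) (fun x : g.Site => x))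
      (BlockNorm.ofBlocks (toB6 g R H) (fun x : g.Site => x)) T K) :
    ∀ y y' : g.Site, |entry T y y'| ≤ K y y' := by
  intro y y'
  have hloc : (BlockNorm.ofBlocks (toB6 g R H) (fun x : g.Site => x)).IsLoc y' (Pi.single y' (1 : ℝ) : g.Site → ℝ) := by
    intro x hx
    have hx' : (x : g.Site) ≠ y' := hx
    exact Pi.single_eq_of_ne hx' _
  have h1 := h y' (Pi.single y' (1 : ℝ) : g.Site → ℝ) hloc y
  rw [loc_ofBlocks_id, loc_ofBlocks_id] at h1
  simpa [entry] using h1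

variable {ν : ℕ} {Nf : ℕ → Fin ν → ℕ} [∀ n i, NeZero (Nf n i)]

/-- **(190) AS AN ENTRYWISE KERNEL BOUND ON THE SITE TORUS** (scalar model): let, on the n-th torus `UT (Nf n)`, the Sect. G
operators be linear maps of `UT (Nf n) → ℝ` — G̃ (`Gt`), W = ((δ²∕δA′²)V)(𝒜₀ + H₀B) (`W`), Δ⁽²⁾H₀ (`D2H0`), H₀ (`H0`), H
(`Hk`), 𝔄₀ = (δ∕δB)𝒜₀ (`A0`), 𝔇 (`Dfr`) and δ𝓗 = (δ∕δB)𝓗 (`dH`) — with the located ENTRYWISE letters of print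
(torus-free constants, rate δ₀ > 0): `|G̃(δ_{y′})(y)| ≤ B_G e^{−δ₀d₁(y,y′)}`, (189) `|W(δ_{y′})(y)| ≤ θ_W e^{−¼δ₀d₁}`
(author-omitted, cell GAPS G-B11-G2), `|Δ⁽²⁾H₀(δ_{y′})(y)| ≤ c_Δ e^{−δ₀d₁}`, `|H₀(δ_{y′})(y)| ≤ A₀ e^{−δ₀d₁}`,
`|H(δ_{y′})(y)| ≤ A_H e^{−½δ₀d₁}`, `|𝔇(δ_{y′})(y)| ≤ θ_𝔇 e^{−½δ₀d₁}`, (188) `|𝔄₀(δ_{y′})(y)| ≤ M₀(n)`, the carriers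
(184) and (182), the Neumann ratio of (187) `qG 1 1 B_G θ_W c < 1` and a constant `Cst` above the written-out O(1) at
cutting constants 1 and row-sum constant `c ≥ c₀(σ∕δ₀)^ν` (`0 < σ ≤ ⅛δ₀`).  THEN for every torus n and all sites y, y′:
`|δ𝓗_n(δ_{y′})(y)| ≤ Cst · e^{−⅛δ15·d₁(y,y′)}` (any `δ15 ≤ δ₀`) — §1 in the sharp one-site sizes
(`BlockNorm.ofBlocks … (fun y => y)`, κ = 1) read back through `entry_le_of_hasMaj_ofBlocks_id`.  This is the currency of
the tree's NODE-O walk objects (entrywise majorants).  Nothing of Bałaban's is constructed; the operators are parameters.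
[cite: Balaban1985Variational, (182)-(190) pp.307-308; Balaban1984PropagatorsII, (2.51) p.232, Lemma 2.1 (2.61) p.234] -/
theorem entry190_of_sectG_torusGeom
    (Gt W D2H0 H0 Hk A0 dH Dfr : (n : ℕ) → Module.End ℝ (UT (Nf n) → ℝ)) (M₀ : ℕ → ℝ)
    {δ₀ σ c BG θW cΔ A₀ AH₂ θD Cst δ15 : ℝ}
    (hδ₀ : 0 < δ₀) (hσ₀ : 0 < σ) (hσ : σ ≤ δ₀ / 8) (hc : B6.c0 δ₀ (σ / δ₀) ^ ν ≤ c)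
    (hBG : 0 ≤ BG) (hθW : 0 ≤ θW) (hcΔ : 0 ≤ cΔ) (hA₀ : 0 ≤ A₀) (hAH₂ : 0 ≤ AH₂) (hθD : 0 ≤ θD) (hM₀ : ∀ n, 0 ≤ M₀ n)
    (hG : ∀ n (y y' : UT (Nf n)), |entry (Gt n) y y'| ≤ BG * Real.exp (-(δ₀ * tdist1 (Nf n) y y')))
    (h189 : ∀ n (y y' : UT (Nf n)), |entry (W n) y y'| ≤ θW * Real.exp (-(δ₀ / 4 * tdist1 (Nf n) y y')))
    (hD2H0 : ∀ n (y y' : UT (Nf n)), |entry (D2H0 n) y y'| ≤ cΔ * Real.exp (-(δ₀ * tdist1 (Nf n) y y')))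
    (hH0 : ∀ n (y y' : UT (Nf n)), |entry (H0 n) y y'| ≤ A₀ * Real.exp (-(δ₀ * tdist1 (Nf n) y y')))
    (hH : ∀ n (y y' : UT (Nf n)), |entry (Hk n) y y'| ≤ AH₂ * Real.exp (-(δ₀ / 2 * tdist1 (Nf n) y y')))
    (hDfr : ∀ n (y y' : UT (Nf n)), |entry (Dfr n) y y'| ≤ θD * Real.exp (-(δ₀ / 2 * tdist1 (Nf n) y y')))
    (h188 : ∀ n (y y' : UT (Nf n)), |entry (A0 n) y y'| ≤ M₀ n)
    (h184 : ∀ n, Eq184 (A0 n) (H0 n) (Gt n) (W n) (D2H0 n))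
    (h182 : ∀ n, Eq182 (dH n) (A0 n) (H0 n) (Hk n) (Dfr n))
    (hq : qG 1 1 BG θW c < 1)
    (hCst : (1 * BG * (cΔ + 1 * θW * (A₀ + constA0 1 1 BG θW cΔ A₀ c) * c) * c + A₀) +
        1 * AH₂ * (1 * θD * (constA0 1 1 BG θW cΔ A₀ c + A₀) * c) * c ≤ Cst)
    (hδ15 : δ15 ≤ δ₀) :
    ∀ n (y y' : UT (Nf n)), |entry (dH n) y y'| ≤ Cst * Real.exp (-(δ15 / 8 * tdist1 (Nf n) y y')) := by
  intro n
  have hexp : ∀ (a r : ℝ), 0 ≤ a → ∀ m (y y' : UT (Nf m)), 0 ≤ a * Real.exp (-(r * tdist1 (Nf m) y y')) :=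
    fun a r ha m y y' => mul_nonneg ha (Real.exp_nonneg _)
  -- the geometry letters η, L, M, R, H of `torusGeom`/`toB6` are carried, never read: take them trivial
  have h190 := h190_of_sectG_torusGeom (I := Unit) (Nf := Nf) (η := fun _ => 0) (L := fun _ => 0) (M := fun _ => 0)
    (R := fun _ => 0) (H := fun _ => True)
    (fun n => BlockNorm.ofBlocks (toB6 (torusGeom (Nf n) 0 0 0) 0 True) (fun x : UT (Nf n) => x))
    (fun n => BlockNorm.ofBlocks (toB6 (torusGeom (Nf n) 0 0 0) 0 True) (fun x : UT (Nf n) => x))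
    (fun n => BlockNorm.ofBlocks (toB6 (torusGeom (Nf n) 0 0 0) 0 True) (fun x : UT (Nf n) => x))
    (fun n _ => BlockNorm.ofBlocks (toB6 (torusGeom (Nf n) 0 0 0) 0 True) (fun x : UT (Nf n) => x))
    Gt W D2H0 H0 Hk A0 dH Dfr M₀ (κB := 1) (κN := 1) (κ₃ := 1) (BG₂ := BG) (A₀₂ := A₀)
    hδ₀ hσ₀ hσ hc hBG hBG hθW hcΔ hA₀ hA₀ hAH₂ hθD hM₀ (fun _ => le_rfl) (fun _ => le_rfl) (fun _ => le_rfl)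
    (fun n => hasMaj_ofBlocks_id_of_entry (hexp BG δ₀ hBG n) (hG n))
    (fun n _ => hasMaj_ofBlocks_id_of_entry (hexp BG δ₀ hBG n) (hG n))
    (fun n => hasMaj_ofBlocks_id_of_entry (hexp θW (δ₀ / 4) hθW n) (h189 n))
    (fun n => hasMaj_ofBlocks_id_of_entry (hexp cΔ δ₀ hcΔ n) (hD2H0 n))
    (fun n => hasMaj_ofBlocks_id_of_entry (hexp A₀ δ₀ hA₀ n) (hH0 n))
    (fun n _ => hasMaj_ofBlocks_id_of_entry (hexp A₀ δ₀ hA₀ n) (hH0 n))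
    (fun n _ => hasMaj_ofBlocks_id_of_entry (hexp AH₂ (δ₀ / 2) hAH₂ n) (hH n))
    (fun n => hasMaj_ofBlocks_id_of_entry (hexp θD (δ₀ / 2) hθD n) (hDfr n))
    h184 (fun n => hasMaj_ofBlocks_id_of_entry (fun _ _ => hM₀ n) (h188 n)) h182 hq hCst hδ15
  exact entry_le_of_hasMaj_ofBlocks_id (h190 n ())

end Entrywise

end Literature.MathematicalPhysics.QuantumFieldTheory.Balaban1983to89.Beta.RemainderDecay190SectGTorus
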